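import Summits.NavierStokesRegularity.NavierStokesRegularity.Theorems.SqueezeCycleSingularProfileOfNontrivialMorreySlice

/-!
# Route SqueezeCycle · item `SingularProfileOfNontrivial` (stmt-NavierStokesRegularity-15368):
# the pressure potential `Q[v]` for MORREY slices

Helper file (theorems only), sequel of `…MorreySlice.lean`: the Morrey-class twins of the far-potential
section of `PineauVicolPressureDecayClass.lean` / `PineauVicolPressureDuality.lean`. For a slice `v` with
the scale-invariant Morrey bound `∫_{B(x,r)} |v|² ≤ A r` (`r ≥ 1`; no square integrability, no decay):
`Q[v] ∈ C²` and the Poisson equation `ΔQ[v] = −∂ᵢ∂ⱼ(vᵢvⱼ)` (`Q = pressurePotential`), independence of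
the cutoff scale, and the uniform far-field bounds `‖D²Γ∞^{R,2R}(z)‖ ≤ K₀(1+|z|)⁻³` (`R ≥ 1`),
`|Q₂^{R,2R}[v]| ≤ K A`.

References: T. Tao, Anal. PDE 6 (2013), §4, proof of Lemma 4.1 (i) [Tao2011]; D. Albritton, T. Barker,
J. Math. Fluid Mech. 21 (2019) = arXiv:1811.00502, §1, §3 [AlbrittonBarker2019]; G. Koch, N. Nadirashvili,
G. Seregin, V. Šverák, Acta Math. 203 (2009) [KochNadirashviliSereginSverak2009].
-/

noncomputable section

-- the sub-problem namespace repeats the summit name (D-0017 layout `Summit.<S>.<P>.Theorems`)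
set_option linter.dupNamespace false
-- nested operator types `ℝ³ →L[ℝ] ℝ³ →L[ℝ] ℝ³ →L[ℝ] ℝ` (pressure kernels)
set_option maxSynthPendingDepth 3

namespace Summit.NavierStokesRegularity.NavierStokesRegularity.Theorems.SingularProfile

open MeasureTheory Set Filter Metric Function
open _root_.Topology
open scoped ENNReal NNReal Laplacian ContDiff RealInnerProductSpace
open Literature.Analysis.FluidPDE
open Literature.Analysis.FluidPDE.FourierNS (HasDecay)

variable {r₀ r₁ : ℝ}

/-- The weight `y ↦ evalDiag (v y)` of a Morrey field is a Morrey operator weight with the same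
constant (`‖evalDiag a‖ ≤ |a|²`). [folklore] -/
theorem morrey_evalDiag {v : (EuclideanSpace ℝ (Fin 3)) → (EuclideanSpace ℝ (Fin 3))}
    (hvc : Continuous v) {A : ℝ}
    (hA : ∀ (x : EuclideanSpace ℝ (Fin 3)) (r : ℝ), 1 ≤ r → ∫ y in ball x r, ‖v y‖ ^ 2 ≤ A * r)
    (x : EuclideanSpace ℝ (Fin 3)) (r : ℝ) (hr : 1 ≤ r) :
    ∫ y in ball x r, ‖evalDiag (v y)‖ ≤ A * r := by
  have h1 : IntegrableOn (fun y => ‖evalDiag (v y)‖) (ball x r) volume :=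
    ((continuous_evalDiag.comp hvc).norm.continuousOn.integrableOn_compact
      (isCompact_closedBall x r)).mono_set ball_subset_closedBall
  have h2 : IntegrableOn (fun y => ‖v y‖ ^ 2) (ball x r) volume :=
    ((hvc.norm.pow 2).continuousOn.integrableOn_compact (isCompact_closedBall x r)).mono_set
      ball_subset_closedBall
  exact (setIntegral_mono_on h1 h2 measurableSet_ball fun y _ => norm_evalDiag_le (v y)).trans
    (hA x r hr)

/-- The far integrand `y ↦ D²Γ∞(x − y)(v y, v y)` is integrable for the Morrey class. [folklore] -/
theorem integrable_farPotential_integrand_morrey (h₀ : 0 < r₀) (h₁ : r₀ < r₁)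
    {v : (EuclideanSpace ℝ (Fin 3)) → (EuclideanSpace ℝ (Fin 3))} (hvc : Continuous v) {A : ℝ}
    (hA : ∀ (x : EuclideanSpace ℝ (Fin 3)) (r : ℝ), 1 ≤ r → ∫ y in ball x r, ‖v y‖ ^ 2 ≤ A * r)
    (x : EuclideanSpace ℝ (Fin 3)) :
    Integrable fun y => fderiv ℝ (fderiv ℝ (newtonFar r₀ r₁)) (x - y) (v y) (v y) := by
  obtain ⟨⟨M₀, hM₀⟩, -, -⟩ := PineauVicol2026.exists_hasDecay_fderiv_newtonFar h₀ h₁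
  exact (integrable_clm_apply_comp_sub_morrey (L := fun y => evalDiag (v y))
    (contDiff_fderiv2_newtonFar h₀ h₁).continuous hM₀ (continuous_evalDiag.comp hvc)
    (morrey_evalDiag hvc hA) x).1

/-- **`Q₂[v] ∈ C²`** with the formula `∂ₐ∂ₐQ₂[v](x) = ∫ D⁴Γ∞(x - y)(a, a, v y, v y) dy`, for `v`
continuous in the Morrey class (decaying kernels `D²Γ∞, D³Γ∞, D⁴Γ∞` against the non-integrable
weight `v ⊗ v`). [folklore] -/
theorem contDiff_farPotential_morrey (h₀ : 0 < r₀) (h₁ : r₀ < r₁)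
    {v : (EuclideanSpace ℝ (Fin 3)) → (EuclideanSpace ℝ (Fin 3))} (hvc : Continuous v) {A : ℝ}
    (hA : ∀ (x : EuclideanSpace ℝ (Fin 3)) (r : ℝ), 1 ≤ r → ∫ y in ball x r, ‖v y‖ ^ 2 ≤ A * r) :
    ContDiff ℝ 2 (farPotential r₀ r₁ v) ∧
      ∀ x a, fderiv ℝ (fun x' => fderiv ℝ (farPotential r₀ r₁ v) x' a) x a =
        ∫ y, fderiv ℝ (fderiv ℝ (fderiv ℝ (fderiv ℝ (newtonFar r₀ r₁)))) (x - y) a a (v y) (v y) := by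
  obtain ⟨⟨M₀, hM₀⟩, ⟨M₁, hM₁⟩, ⟨M₂, hM₂⟩⟩ := PineauVicol2026.exists_hasDecay_fderiv_newtonFar h₀ h₁
  have h := contDiff_two_integral_clm_apply_comp_sub_morrey (L := fun y => evalDiag (v y))
    (contDiff_fderiv2_newtonFar h₀ h₁) hM₀ hM₁ hM₂ (continuous_evalDiag.comp hvc)
    (morrey_evalDiag hvc hA)
  rw [farPotential_eq]
  refine ⟨h.1, fun x a => ?_⟩
  rw [h.2 x a]
  rfl

/-- **`ΔQ₂[v] = λ * G[v]`** for `v ∈ C²` in the Morrey class (as `laplacian_farPotential`, with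
the Morrey-class parametric integrals). [cite: GilbargTrudinger2001, Lemma 4.2] -/
theorem laplacian_farPotential_morrey (h₀ : 0 < r₀) (h₁ : r₀ < r₁)
    {v : (EuclideanSpace ℝ (Fin 3)) → (EuclideanSpace ℝ (Fin 3))} (hv2 : ContDiff ℝ 2 v) {A : ℝ}
    (hA : ∀ (x : EuclideanSpace ℝ (Fin 3)) (r : ℝ), 1 ≤ r → ∫ y in ball x r, ‖v y‖ ^ 2 ≤ A * r)
    (x : EuclideanSpace ℝ (Fin 3)) :
    Δ (farPotential r₀ r₁ v) x = ∫ z, newtonFarLaplacian r₀ r₁ z * pressureSource v (x - z) := by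
  set b := stdOrthonormalBasis ℝ (EuclideanSpace ℝ (Fin 3))
  obtain ⟨hQ, hQ2⟩ := contDiff_farPotential_morrey h₀ h₁ hv2.continuous hA
  rw [Literature.Analysis.FluidPDE.laplacian_eq_sum_fderiv_fderiv b hQ x]
  simp_rw [hQ2]
  obtain ⟨-, -, ⟨M₂, hM₂⟩⟩ := PineauVicol2026.exists_hasDecay_fderiv_newtonFar h₀ h₁
  set D4 := fderiv ℝ (fderiv ℝ (fderiv ℝ (fderiv ℝ (newtonFar r₀ r₁)))) with hD4
  have hD4c : Continuous D4 :=
    ((contDiff_fderiv2_newtonFar h₀ h₁).fderiv_right (m := 1) le_rfl).continuous_fderiv one_ne_zero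
  have hint : ∀ i, Integrable fun y => D4 (x - y) (b i) (b i) (v y) (v y) := fun i => by
    have hΦc : Continuous fun z => D4 z (b i) (b i) :=
      (hD4c.clm_apply continuous_const).clm_apply continuous_const
    have hΦb : HasDecay 3 (M₂ * ‖b i‖ * ‖b i‖) (fun z => D4 z (b i) (b i)) := fun z =>
      calc ‖D4 z (b i) (b i)‖ ≤ ‖D4 z (b i)‖ * ‖b i‖ := ContinuousLinearMap.le_opNorm _ _
        _ ≤ ‖D4 z‖ * ‖b i‖ * ‖b i‖ := by gcongr; exact ContinuousLinearMap.le_opNorm _ _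
        _ ≤ M₂ * ((1 + ‖z‖) ^ 3)⁻¹ * ‖b i‖ * ‖b i‖ := by gcongr; exact hM₂ z
        _ = M₂ * ‖b i‖ * ‖b i‖ * ((1 + ‖z‖) ^ 3)⁻¹ := by ring
    exact (integrable_clm_apply_comp_sub_morrey (L := fun y => evalDiag (v y)) hΦc hΦb
      (continuous_evalDiag.comp hv2.continuous) (morrey_evalDiag hv2.continuous hA) x).1
  rw [← integral_finsetSum _ fun i _ => hint i]
  have key : ∀ y, ∑ i, D4 (x - y) (b i) (b i) (v y) (v y) =
      fderiv ℝ (fderiv ℝ (newtonFarLaplacian r₀ r₁)) (x - y) (v y) (v y) := fun y =>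
    sum_fderiv4_newtonFar_apply h₀ h₁ b (x - y) (v y)
  rw [integral_congr_ae (Eventually.of_forall key)]
  have hlam : ContDiff ℝ 2 (newtonFarLaplacian r₀ r₁) := contDiff_newtonFarLaplacian h₀ h₁
  rw [← integral_comp_sub_mul_pressureSource hlam (hasCompactSupport_newtonFarLaplacian h₀.le h₁)
    hv2 x, ← integral_sub_left_eq_self
    (fun z => newtonFarLaplacian r₀ r₁ z * pressureSource v (x - z)) volume x]
  simp only [sub_sub_cancel]

/-- **`Q[v] ∈ C²`** for `v ∈ C⁴` in the Morrey class. [cite: GilbargTrudinger2001, Lemma 4.2] -/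
theorem contDiff_pressurePotential_morrey
    {v : (EuclideanSpace ℝ (Fin 3)) → (EuclideanSpace ℝ (Fin 3))} (hv4 : ContDiff ℝ 4 v) {A : ℝ}
    (hA : ∀ (x : EuclideanSpace ℝ (Fin 3)) (r : ℝ), 1 ≤ r → ∫ y in ball x r, ‖v y‖ ^ 2 ≤ A * r) :
    ContDiff ℝ 2 (pressurePotential v) := by
  have h1 : ContDiff ℝ 2 (nearPotential 1 2 v) :=
    contDiff_nearPotential zero_le_one one_lt_two 2 (by exact_mod_cast hv4)
  have h2 : ContDiff ℝ 2 (farPotential 1 2 v) :=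
    (contDiff_farPotential_morrey one_pos one_lt_two hv4.continuous hA).1
  exact h1.neg.sub h2

/-- **The Poisson equation `ΔQ[v] = −∂ᵢ∂ⱼ(vᵢvⱼ)` for the Morrey class**: for `v ∈ C⁴` with
`∫_{B(x,r)} |v|² ≤ A r` (`r ≥ 1`) — in particular for every time slice of a member of the
Type-I model class 𝒦_C, which is not square integrable. [cite: GilbargTrudinger2001, Lemma 4.2] -/
theorem laplacian_pressurePotential_morrey
    {v : (EuclideanSpace ℝ (Fin 3)) → (EuclideanSpace ℝ (Fin 3))} (hv4 : ContDiff ℝ 4 v) {A : ℝ}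
    (hA : ∀ (x : EuclideanSpace ℝ (Fin 3)) (r : ℝ), 1 ≤ r → ∫ y in ball x r, ‖v y‖ ^ 2 ≤ A * r)
    (x : EuclideanSpace ℝ (Fin 3)) :
    Δ (pressurePotential v) x = -pressureSource v x := by
  have h1 : ContDiff ℝ 2 (nearPotential 1 2 v) :=
    contDiff_nearPotential zero_le_one one_lt_two 2 (by exact_mod_cast hv4)
  have h2 : ContDiff ℝ 2 (farPotential 1 2 v) :=
    (contDiff_farPotential_morrey one_pos one_lt_two hv4.continuous hA).1
  have e : pressurePotential v = -(nearPotential 1 2 v + farPotential 1 2 v) := by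
    funext y
    simp only [pressurePotential, Pi.neg_apply, Pi.add_apply]
    ring
  rw [e, InnerProductSpace.laplacian_neg, Pi.neg_apply,
    (h1.contDiffAt).laplacian_add h2.contDiffAt,
    laplacian_nearPotential one_pos one_lt_two hv4,
    laplacian_farPotential_morrey one_pos one_lt_two (hv4.of_le (by norm_num)) hA]
  ring

/-- **Independence of the cutoff scale for the Morrey class**: `Q[v] = −Q₁^R[v] − Q₂^R[v]`
with cutoff radii `(R, 2R)`, `R > 0`, for `v ∈ C²` in the Morrey class
(as `pressurePotential_eq_scale`). [folklore] -/
theorem pressurePotential_eq_scale_morrey {R : ℝ} (hR : 0 < R)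
    {v : (EuclideanSpace ℝ (Fin 3)) → (EuclideanSpace ℝ (Fin 3))} (hv2 : ContDiff ℝ 2 v) {A : ℝ}
    (hA : ∀ (x : EuclideanSpace ℝ (Fin 3)) (r : ℝ), 1 ≤ r → ∫ y in ball x r, ‖v y‖ ^ 2 ≤ A * r)
    (x : EuclideanSpace ℝ (Fin 3)) :
    pressurePotential v x =
      -nearPotential (R * 1) (R * 2) v x - farPotential (R * 1) (R * 2) v x := by
  have hR1 : 0 < R * 1 := by linarith
  have hR2 : R * 1 < R * 2 := by linarith
  set Ψ : (EuclideanSpace ℝ (Fin 3)) → ℝ := fun z => newtonFar 1 2 z - newtonFar (R * 1) (R * 2) z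
    with hΨ
  have hΨs : ContDiff ℝ 2 Ψ := (contDiff_newtonFar one_pos one_lt_two).sub
    (contDiff_newtonFar hR1 hR2)
  have hΨc : HasCompactSupport Ψ := by
    refine HasCompactSupport.intro (isCompact_closedBall (0 : EuclideanSpace ℝ (Fin 3))
      (max 2 (R * 2))) fun z hz => ?_
    rw [mem_closedBall_zero_iff, not_le, max_lt_iff] at hz
    simp only [hΨ]
    rw [newtonFar_eq_newtonKernel zero_le_one one_lt_two hz.1.le,
      newtonFar_eq_newtonKernel hR1.le hR2 hz.2.le, sub_self]
  have h1 : nearPotential (R * 1) (R * 2) v x - nearPotential 1 2 v x =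
      ∫ z, Ψ z * pressureSource v (x - z) := by
    rw [nearPotential, nearPotential, ← integral_sub
      (integrable_nearPotential_integrand hR1.le hR2 hv2 x)
      (integrable_nearPotential_integrand zero_le_one one_lt_two hv2 x)]
    refine integral_congr_ae (Eventually.of_forall fun z => ?_)
    simp only [hΨ]
    rw [← sub_mul, newtonNear_sub_newtonNear]
  have h2 : ∫ z, Ψ z * pressureSource v (x - z) =
      farPotential 1 2 v x - farPotential (R * 1) (R * 2) v x := by
    rw [← integral_sub_left_eq_self (fun z => Ψ z * pressureSource v (x - z)) volume x]
    simp only [sub_sub_cancel]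
    rw [integral_comp_sub_mul_pressureSource hΨs hΨc hv2 x, farPotential, farPotential,
      ← integral_sub (integrable_farPotential_integrand_morrey one_pos one_lt_two hv2.continuous hA x)
        (integrable_farPotential_integrand_morrey hR1 hR2 hv2.continuous hA x)]
    refine integral_congr_ae (Eventually.of_forall fun y => ?_)
    dsimp only
    rw [fderiv2_sub (contDiff_newtonFar one_pos one_lt_two) (contDiff_newtonFar hR1 hR2)]
    rfl
  rw [pressurePotential]
  linarith [h1, h2]

/-- **A uniform decay bound for `D²Γ∞` at all scales `R ≥ 1`**: there is `K₀` with
`‖D²Γ∞^{R,2R}(z)‖ ≤ K₀ (1+|z|)⁻³` for all `R ≥ 1` and all `z` (near `0`: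
`‖D²Γ∞^{R,2R}‖ ≤ m₂R⁻³ ≤ 27 m₂ (1+|z|)⁻³` for `|z| ≤ 2R`; far: `‖D²Γ(z)‖ ≤ M|z|⁻³` by
homogeneity and `(1+|z|)³ ≤ (27/8)|z|³` for `|z| ≥ 2`). [folklore] -/
theorem exists_hasDecay_fderiv2_newtonFar_scale :
    ∃ K₀ : ℝ, ∀ R : ℝ, 1 ≤ R →
      HasDecay 3 K₀ (fderiv ℝ (fderiv ℝ (newtonFar (R * 1) (R * 2)))) := by
  obtain ⟨m₂, -, -, hm₂, -, -⟩ :=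
    exists_bounds_fderiv2_newtonFar (r₀ := (1 : ℝ)) (r₁ := 2) one_pos one_lt_two
  have hm₂0 : 0 ≤ m₂ := (norm_nonneg _).trans (hm₂ 0)
  obtain ⟨M2, hM20, hM2⟩ := PineauVicol2026.exists_decay_of_homogeneous _ (-3) (by norm_num)
    fderiv2_newtonKernel_homogeneous (contDiffOn_fderiv2_newtonKernel (n := 0)).continuousOn
  refine ⟨27 * m₂ + 27 / 8 * M2, fun R hR z => ?_⟩
  have hR0 : 0 < R := one_pos.trans_le hR
  have hR1 : 0 < R * 1 := by linarith
  have hR2 : R * 1 < R * 2 := by linarith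
  have h1z : 0 < 1 + ‖z‖ := by positivity
  by_cases hz : ‖z‖ ≤ 2 * R
  · -- near: `m₂ R⁻³ ≤ 27 m₂ (1+|z|)⁻³`
    have hk : ‖fderiv ℝ (fderiv ℝ (newtonFar (R * 1) (R * 2))) z‖ ≤ R⁻¹ ^ 3 * m₂ :=
      norm_fderiv2_newtonFar_scale_le hR0 hm₂ z
    have hcmp : R⁻¹ ^ 3 ≤ 27 * ((1 + ‖z‖) ^ 3)⁻¹ := by
      rw [inv_pow, show (27 : ℝ) * ((1 + ‖z‖) ^ 3)⁻¹ = ((1 + ‖z‖) ^ 3 / 27)⁻¹ by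
        rw [inv_div]; ring]
      refine inv_anti₀ (by positivity) ?_
      have : (1 + ‖z‖) ^ 3 ≤ (3 * R) ^ 3 := pow_le_pow_left₀ h1z.le (by linarith) 3
      nlinarith
    calc ‖fderiv ℝ (fderiv ℝ (newtonFar (R * 1) (R * 2))) z‖ ≤ R⁻¹ ^ 3 * m₂ := hk
      _ ≤ 27 * ((1 + ‖z‖) ^ 3)⁻¹ * m₂ := mul_le_mul_of_nonneg_right hcmp hm₂0
      _ = 27 * m₂ * ((1 + ‖z‖) ^ 3)⁻¹ := by ring
      _ ≤ (27 * m₂ + 27 / 8 * M2) * ((1 + ‖z‖) ^ 3)⁻¹ := by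
          refine mul_le_mul_of_nonneg_right ?_ (by positivity)
          linarith [mul_nonneg (by norm_num : (0:ℝ) ≤ 27 / 8) hM20]
  · -- far: `M2 |z|⁻³ ≤ (27/8) M2 (1+|z|)⁻³`
    rw [not_le] at hz
    have hz2 : 2 ≤ ‖z‖ := by linarith
    have hz1 : 1 ≤ ‖z‖ := by linarith
    rw [(newtonFar_fderiv_iterates_eq hR1.le hR2 (by linarith : R * 2 < ‖z‖)).2.2.1]
    have hk := hM2 z hz1
    have hz3 : ‖z‖ ^ (-3 : ℤ) = (‖z‖ ^ 3)⁻¹ := by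
      rw [show (-3 : ℤ) = -((3 : ℕ) : ℤ) by norm_num, zpow_neg, zpow_natCast]
    rw [hz3] at hk
    have hcmp : (‖z‖ ^ 3)⁻¹ ≤ 27 / 8 * ((1 + ‖z‖) ^ 3)⁻¹ := by
      rw [show (27 : ℝ) / 8 * ((1 + ‖z‖) ^ 3)⁻¹ = ((1 + ‖z‖) ^ 3 / (27 / 8))⁻¹ by
        rw [inv_div]; ring]
      refine inv_anti₀ (by positivity) ?_
      have : (1 + ‖z‖) ^ 3 ≤ (3 / 2 * ‖z‖) ^ 3 := pow_le_pow_left₀ h1z.le (by linarith) 3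
      nlinarith
    calc ‖fderiv ℝ (fderiv ℝ newtonKernel) z‖ ≤ M2 * (‖z‖ ^ 3)⁻¹ := hk
      _ ≤ M2 * (27 / 8 * ((1 + ‖z‖) ^ 3)⁻¹) := mul_le_mul_of_nonneg_left hcmp hM20
      _ = 27 / 8 * M2 * ((1 + ‖z‖) ^ 3)⁻¹ := by ring
      _ ≤ (27 * m₂ + 27 / 8 * M2) * ((1 + ‖z‖) ^ 3)⁻¹ := by
          refine mul_le_mul_of_nonneg_right ?_ (by positivity)
          linarith [mul_nonneg (by norm_num : (0:ℝ) ≤ 27) hm₂0]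

/-- **The far potential at scale `(R, 2R)` is uniformly bounded on the Morrey class**: there is
a universal `K` with `|Q₂^{R,2R}[v](x)| ≤ K A` for all `R ≥ 1`, `x`, and `v` continuous with
`∫_{B(y,r)}|v|² ≤ A r` (`r ≥ 1`) (`‖D²Γ∞^{R,2R}(z)‖ ≤ K₀(1+|z|)⁻³` against the dyadic bound
`∫|v|²(1+|x−y|)⁻³ ≤ 4A`). [folklore] -/
theorem exists_bound_farPotential_scale_morrey :
    ∃ K : ℝ, 0 ≤ K ∧ ∀ (v : (EuclideanSpace ℝ (Fin 3)) → (EuclideanSpace ℝ (Fin 3))) (A : ℝ),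
      Continuous v →
      (∀ (x : EuclideanSpace ℝ (Fin 3)) (r : ℝ), 1 ≤ r → ∫ y in ball x r, ‖v y‖ ^ 2 ≤ A * r) →
      ∀ (R : ℝ), 1 ≤ R → ∀ x : EuclideanSpace ℝ (Fin 3),
        |farPotential (R * 1) (R * 2) v x| ≤ K * A := by
  obtain ⟨K₀, hK₀⟩ := exists_hasDecay_fderiv2_newtonFar_scale
  have hK₀0 : 0 ≤ K₀ := (hK₀ 1 le_rfl).nonneg
  refine ⟨4 * K₀, by positivity, fun v A hvc hA R hR x => ?_⟩
  have hR1 : 0 < R * 1 := by linarith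
  have hR2 : R * 1 < R * 2 := by linarith
  have h := norm_integral_clm_apply_comp_sub_le_morrey (L := fun y => evalDiag (v y))
    (contDiff_fderiv2_newtonFar hR1 hR2).continuous (hK₀ R hR) (continuous_evalDiag.comp hvc)
    (morrey_evalDiag hvc hA) x
  rw [Real.norm_eq_abs] at h
  calc |farPotential (R * 1) (R * 2) v x|
      = |∫ y, evalDiag (v y) (fderiv ℝ (fderiv ℝ (newtonFar (R * 1) (R * 2))) (x - y))| := by
        rw [farPotential_eq]
    _ ≤ 4 * K₀ * A := h

/-- **`|Q₂[v](x)| ≤ K A`** at the unit cutoff scale `(1, 2)` (the case `R = 1`). [folklore] -/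
theorem exists_bound_farPotential_morrey :
    ∃ K : ℝ, 0 ≤ K ∧ ∀ (v : (EuclideanSpace ℝ (Fin 3)) → (EuclideanSpace ℝ (Fin 3))) (A : ℝ),
      Continuous v →
      (∀ (x : EuclideanSpace ℝ (Fin 3)) (r : ℝ), 1 ≤ r → ∫ y in ball x r, ‖v y‖ ^ 2 ≤ A * r) →
      ∀ x : EuclideanSpace ℝ (Fin 3), |farPotential 1 2 v x| ≤ K * A := by
  obtain ⟨K, hK0, hK⟩ := exists_bound_farPotential_scale_morrey
  refine ⟨K, hK0, fun v A hvc hA x => ?_⟩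
  have h := hK v A hvc hA 1 le_rfl x
  norm_num at h
  exact h

end Summit.NavierStokesRegularity.NavierStokesRegularity.Theorems.SingularProfile
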